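import Summits.HodgeConjecture.HodgeConjecture.Theorems.F0P3HolFormArchIsotypy
import Summits.HodgeConjecture.HodgeConjecture.Theorems.F0P3HolFormKType
import Literature.NumberTheory.Automorphic.HeckeEigenvectorProjection
import HarnessLib

/-!
# Crux `H413` — F1b road (HILBERT ROUTE), brick HB2 = (H1): a closed `P|_G`-invariant subspace whose Harish-Chandra core is DENSE and
# IRREDUCIBLE is TOPOLOGICALLY IRREDUCIBLE; the closure `C_Φ` of a holomorphic cotangent form in `P|_{U(2,1)}` is topologically irreducible

Floor-0 programme P3 «U3-mult», seat F0P3-p04 (g4); crux item stmt-HodgeConjecture-24833 (`HCCMUnconditional.H413`), line of record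
`Cruxes/H413/Lines/F0_U3LettersRung1.lean` ed. 2.5 (open stub `stub_F1b_cm : StubF1bCM`[v5]); road memo `F0/P3/F0P3-p04/ROAD-F1b-Hilbert.F0P3p04g4.md`
step (H1) (planner ruling 2026-08-31T03:23:27Z).  The hypothesis `hW : W.toContRep.IsTopIrreducible` of HB1 ★∕pending `F0P3IsotypicOfCommutingFactor`
(§3 `archRepCM_isotypicComponent_eq_top`) and the `N = C_Φ` input of the GNS step (★ Dixmier 13.1.4 `areUnitarilyEquivalent_of_inner_map_eq`) for the
hol-form closure `W_Φ`.  HC_CM is proved only modulo the printed citations until rung 0 closes.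

* §1 GENERIC (D4 level: a discrete automorphic `P`, a real factor `(G, ιG)`, a closed `P|_G`-invariant `W` with Harish-Chandra core
  `core W = W ⊓ P.archModule G ιG`, ★ B5b `F0P3ArchIsotypyOfIrreducibleCore`): **`isTopIrreducible_of_core`** — if the core is DENSE in `W` and
  IRREDUCIBLE (every `(𝔤, K)`-submodule of `P.archModule` inside it is `⊥` or the core; ★ B1's submodule currency), then `W.toContRep` is
  topologically irreducible.  Proof: for a closed invariant `W′ ≤ W` the orthogonal projection `p_{W′}` commutes with `P|_G` (★ B2
  `starProjection_archRep`), so it induces a `(𝔤, K)`-endomorphism of `P.archModule` (★ `Intertwiner.harishChandraMap`, `archRepK_map`, `archRepLie_map`)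
  mapping the core into `W′ ⊓ P.archModule ≤ core`; its image is a `(𝔤, K)`-submodule inside the core, hence `⊥` (then `core ⟂ W′`, so `W ⟂ W′` by
  density and `W′ = ⊥`) or the core (then `core ≤ W′`, so `W ≤ W′` by density).  No admissibility, no analytic vectors.
* §2 AT THE CM PIN for a HOLOMORPHIC COTANGENT FORM `Φ` with classes in `P` (`L` CM, `[L⁺:ℚ] ≥ 2`, `H` of signature `(2,1)` at `ι` and definite
  elsewhere): **`isTopIrreducible_holClosure`** — the closed `U(2,1)`-invariant `W_Φ ≤ P.archRepCM ι T hT` (★ B5c `exists_closedSubrep_hol`: the classes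
  of `P` lying in the `L²`-closure `C_Φ` of the `𝔤`-span of `Φ`) is topologically irreducible: its core is `gen` of the null core `span {[Φ₀], [Φ₁]}`
  (`core_holClosure_eq_gen`, from ★ B5c `mem_gen_of_coe_mem_holClosure` and ★ B4b `coe_mem_l2OfForms_of_mem_gen`), `gen` is dense in `W_Φ` (★ B4b
  `l2OfForms_eq_map_gen`) and irreducible (★ B1 `eq_bot_or_eq_gen_of_isGKSubmodule` with the cotangent `K`-type ★ p03 `F0P3HolFormKType.hEirr_cm`).
  Corollaries `exists_isTopIrreducible_closedSubrep_hol` and `exists_isTopIrreducible_closedSubrep_of_isHolCotangentAt` (∃-packaged for consumers).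

Sources: Harish-Chandra, *Representations of a semisimple Lie group on a Banach space I*, Trans. AMS 75 (1953), §9 and Thm. 5 («the closure of an
irreducible invariant subspace of well-behaved vectors is topologically irreducible») [HarishChandra1953]; A. Borel, N. Wallach (2000), 0 §2.4–2.5,
II §4.1 [BorelWallach2000]; J. Dixmier, *C\*-algebras* (1977), §13.1.2–13.1.5 [Dixmier1977]; N. R. Wallach, *Real Reductive Groups I* (1988), §1.6, §3.3
[WallachRRG1].

No definition, no sorry, no named fact; `--supports stmt-HodgeConjecture-24833 --as helper`.
-/

set_option autoImplicit false
-- the mandated namespace repeats `HodgeConjecture.HodgeConjecture`, as in every `Theorems/*.lean` of this sub-problem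
set_option linter.dupNamespace false

-- Mathlib idiom (Mathlib/Algebra/Lie/OfAssociative.lean; as in ★ `F0P3HolFormArchIsotypy`): the commutator bracket on `Module.End ℂ V`, needed to mention
-- `pOp` and `(uFormGroup α β).lie →ₗ⁅ℝ⁆ Module.End ℂ V`.
attribute [local instance 100] LieRing.ofAssociativeRing

noncomputable section

open scoped Matrix MatrixGroups Topology InnerProductSpace ENNReal ComplexConjugate ComplexOrder
open MeasureTheory NumberField Filter

universe u

namespace Summit.HodgeConjecture.HodgeConjecture.Cruxes.H413.F0P3HolClosureIrreducible

open Literature.NumberTheory.Automorphic Literature.NumberTheory.Automorphic.UnitaryGroup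
open Literature.NumberTheory.Automorphic.UnitaryGroup.CotangentForms
open Literature.RepresentationTheory.KonnoKonno2007 Literature.RepresentationTheory.KonnoKonno2007.RealDualPair
open Literature.RepresentationTheory.BorelWallach2000
open Literature.Geometry.ComplexHyperbolic.BallModel (U21 J)
open Literature.AlgebraicGeometry.ShimuraVarieties.BallForms (u21Group liePMat)
open Summit.HodgeConjecture.HodgeConjecture.Cruxes.H413.F0P3CotangentFormL2Span
open Summit.HodgeConjecture.HodgeConjecture.Cruxes.H413.F0P3CotangentFormValueMap
open Summit.HodgeConjecture.HodgeConjecture.Cruxes.H413.F0P3ValueMapOfFrameVectors (exists_valueMap valueMap_apply_upqUnit)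
open Summit.HodgeConjecture.HodgeConjecture.Cruxes.H413.F0P3HolProjectionReduction (compactSpace_automorphicQuotient_cm)
open Summit.HodgeConjecture.HodgeConjecture.Cruxes.H413.F0P3bPPartOperators
open Summit.HodgeConjecture.HodgeConjecture.Cruxes.H413.F0P3bPNullGeneration
open Summit.HodgeConjecture.HodgeConjecture.Cruxes.H413.F0P3GenIrreducibleOfUnitary
open Summit.HodgeConjecture.HodgeConjecture.Cruxes.H413.F0P3GenClosureKFinite
open Summit.HodgeConjecture.HodgeConjecture.Cruxes.H413.F0P3HolFormGenClasses
open Summit.HodgeConjecture.HodgeConjecture.Cruxes.H413.F0P3HolFormClosedSubrep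
open Summit.HodgeConjecture.HodgeConjecture.Cruxes.H413.F0P3ArchIsotypyOfIrreducibleCore
open Summit.HodgeConjecture.HodgeConjecture.Cruxes.H413.F0P3HolFormArchIsotypy

/-! ## §1 Generic: dense irreducible Harish-Chandra core ⇒ topologically irreducible -/

section Core

variable {K : Type} [Field K] [NumberField K] {𝒢 : AdelicGroupData.{u} K}
  {μ : Measure 𝒢.automorphicQuotient} [𝒢.IsAutomorphicMeasure μ]
  {A : Type*} [NormedCommRing A] [NormedAlgebra ℝ A] [NormedAlgebra ℚ A] [CompleteSpace A]
  [StarRing A] {N : Type*} [Fintype N] [DecidableEq N]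
  (P : DiscreteAutomorphicRep 𝒢 μ) (G : RealMatrixGroup A N) (ιG : G.carrier →* 𝒢.Adelic) [FiniteDimensional ℝ A] (hι : Continuous ιG)

/-- **Dense irreducible core ⇒ topologically irreducible.**  Let `W` be a closed `P|_G`-invariant subspace of `P` whose Harish-Chandra core
`core W = {w ∈ P.archModule G ιG | w ∈ W}` is non-zero, DENSE in `W`, and IRREDUCIBLE in the sense that every `(𝔤, K)`-submodule of `P.archModule G ιG`
contained in it is `⊥` or the core.  Then `W.toContRep` is topologically irreducible: for a closed invariant `W′ ≤ W`, the orthogonal projection `p_{W′}`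
is a `(𝔤, K)`-endomorphism of `P.archModule` (★ B2) carrying the core into itself; its image is `⊥` (`core ⟂ W′` ⇒ `W ⟂ W′` ⇒ `W′ = 0`) or the core
(`core ≤ W′` ⇒ `W ≤ W′`). [cite: HarishChandra1953, §9 and Thm. 5] [cite: BorelWallach2000, 0 §2.4–2.5] [cite: Dixmier1977, §13.1.2–13.1.5] -/
theorem isTopIrreducible_of_core (W : ContRepresentation.ClosedSubrep (P.archRep G ιG))
    (hne : W.toSubmodule.comap (P.archModule G ιG).subtype ≠ ⊥)
    (hdense : W.toSubmodule ≤ ((W.toSubmodule.comap (P.archModule G ιG).subtype).map (P.archModule G ιG).subtype).topologicalClosure)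
    (hirr : ∀ U : Submodule ℂ (P.archModule G ιG), IsGKSubmodule (P.archRepK G ιG) (P.archRepLie G ιG hι) U →
      U ≤ W.toSubmodule.comap (P.archModule G ιG).subtype →
        U = ⊥ ∨ U = W.toSubmodule.comap (P.archModule G ιG).subtype) :
    W.toContRep.IsTopIrreducible := by
  set C : Submodule ℂ (P.archModule G ιG) := W.toSubmodule.comap (P.archModule G ιG).subtype with hC
  rw [ContRepresentation.ClosedSubrep.isTopIrreducible_toContRep_iff]
  refine ⟨fun hbot => ?_, fun W' hW'le => ?_⟩
  · -- `W ≠ ⊥`: the core is non-zero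
    obtain ⟨c, hc, hc0⟩ := (Submodule.ne_bot_iff _).1 hne
    have hcW : ((c : P.space.toSubmodule)) ∈ W := hc
    rw [hbot, ContRepresentation.ClosedSubrep.mem_bot] at hcW
    exact hc0 (Subtype.ext hcW)
  -- the orthogonal projection onto `W′`, a `(𝔤, K)`-endomorphism of the archimedean module
  have hT : ∀ (g : G.carrier) (v : P.space.toSubmodule),
      W'.toSubmodule.starProjection (P.archRep G ιG g v) = P.archRep G ιG g (W'.toSubmodule.starProjection v) :=
    P.starProjection_archRep G ιG W'
  let φ : P.archModule G ιG →ₗ[ℂ] P.archModule G ιG := Intertwiner.harishChandraMap G hT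
  have hφ : ∀ v : P.archModule G ιG, ((φ v : P.archModule G ιG) : P.space.toSubmodule) = W'.toSubmodule.starProjection (v : P.space.toSubmodule) :=
    fun v => Intertwiner.coe_harishChandraMap_apply G hT v
  -- its image of the core: inside the core, a `(𝔤, K)`-submodule
  let U : Submodule ℂ (P.archModule G ιG) := C.map φ
  have hUle : U ≤ C := by
    rintro _ ⟨c, hc, rfl⟩
    change ((φ c : P.archModule G ιG) : P.space.toSubmodule) ∈ W
    rw [hφ]
    exact hW'le (W'.toSubmodule.starProjection_apply_mem _)
  have hUGK : IsGKSubmodule (P.archRepK G ιG) (P.archRepLie G ιG hι) U := by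
    refine ⟨fun k u hu => ?_, fun X u hu => ?_⟩
    · obtain ⟨c, hc, rfl⟩ := hu
      refine ⟨P.archRepK G ιG k c, core_le_comap_archRepK P G ιG W k hc, ?_⟩
      exact (P.archRepK_map G ιG hT k c)
    · obtain ⟨c, hc, rfl⟩ := hu
      refine ⟨P.archRepLie G ιG hι X c, core_le_comap_archRepLie P G ιG W hι X hc, ?_⟩
      exact (P.archRepLie_map G ιG hT hι X c)
  rcases hirr U hUGK hUle with hU | hU
  · -- `p_{W′}` kills the core: `core ⟂ W′`, hence `W ⟂ W′`, hence `W′ = 0`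
    left
    have hCorth : C.map (P.archModule G ιG).subtype ≤ W'.toSubmoduleᗮ := by
      rintro _ ⟨c, hc, rfl⟩
      have h0 : φ c = 0 := by
        have : φ c ∈ U := ⟨c, hc, rfl⟩
        rwa [hU, Submodule.mem_bot] at this
      have h0' : W'.toSubmodule.starProjection (c : P.space.toSubmodule) = 0 := by
        rw [← hφ, h0]; rfl
      exact (Submodule.starProjection_apply_eq_zero_iff (K := W'.toSubmodule)).mp h0'
    have hWorth : W.toSubmodule ≤ W'.toSubmoduleᗮ :=
      hdense.trans ((Submodule.topologicalClosure_minimal _ hCorth (Submodule.isClosed_orthogonal _)))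
    refine ContRepresentation.ClosedSubrep.ext fun v => ⟨fun hv => ?_, fun hv => ?_⟩
    · have h1 : v ∈ W'.toSubmodule ⊓ W'.toSubmoduleᗮ := ⟨hv, hWorth (hW'le hv)⟩
      rw [Submodule.inf_orthogonal_eq_bot, Submodule.mem_bot] at h1
      rw [h1]
      exact (⊥ : ContRepresentation.ClosedSubrep (P.archRep G ιG)).toSubmodule.zero_mem
    · rw [ContRepresentation.ClosedSubrep.mem_bot] at hv
      rw [hv]
      exact W'.toSubmodule.zero_mem
  · -- `p_{W′}` is onto the core: `core ≤ W′`, hence `W ≤ W′`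
    right
    have hCle : C.map (P.archModule G ιG).subtype ≤ W'.toSubmodule := by
      rintro _ ⟨c, hc, rfl⟩
      have : c ∈ U := by rw [hU]; exact hc
      obtain ⟨c', -, hc'⟩ := this
      rw [← hc', Submodule.coe_subtype, hφ]
      exact W'.toSubmodule.starProjection_apply_mem _
    have hWle : W.toSubmodule ≤ W'.toSubmodule :=
      hdense.trans (Submodule.topologicalClosure_minimal _ hCle W'.isClosed)
    exact le_antisymm hW'le fun v hv => hWle hv

end Core

/-! ## §2 The CM pin: the closure of a holomorphic cotangent form is topologically irreducible under `U(2,1)` -/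

section CM

variable {L : Type} [Field L] [NumberField L] [IsCMField L] (ι : L →+* ℂ) {H : Matrix (Fin 3) (Fin 3) L}
  (T : GL (Fin 3) ℂ) (hT : (T : Matrix (Fin 3) (Fin 3) ℂ)ᴴ * H.map ι * (T : Matrix (Fin 3) (Fin 3) ℂ) = J)

/-- **The Harish-Chandra core of `W_Φ` is `gen` of the null core `span {v₀, v₁}`** of the coordinate classes of `Φ` (the two inclusions are ★ B5c
`mem_gen_of_coe_mem_holClosure` and ★ B4b `coe_mem_l2OfForms_of_mem_gen`; this equality is the `have hcg` inside ★ `archIsotypy_of_hol`, here a lemma).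
[cite: HarishChandra1953, §9] [cite: BorelWallach2000, 0 §2.4–2.5 and II §4.1] -/
theorem core_holClosure_eq_gen
    (hdef : ∀ τ' : L →+* ℂ, InfinitePlace.mk τ' ≠ InfinitePlace.mk ι → (H.map τ').PosDef) (h2 : 2 ≤ Module.finrank ℚ ↥(maximalRealSubfield L))
    (μ : Measure (adelicGroupData (↥(maximalRealSubfield L)) L (IsCMField.complexConj L) 3 H).automorphicQuotient)
    [(adelicGroupData (↥(maximalRealSubfield L)) L (IsCMField.complexConj L) 3 H).IsAutomorphicMeasure μ]
    (P : DiscreteAutomorphicRep (adelicGroupData (↥(maximalRealSubfield L)) L (IsCMField.complexConj L) 3 H) μ)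
    {Φ : (adelicGroupData (↥(maximalRealSubfield L)) L (IsCMField.complexConj L) 3 H).Adelic → (Fin 2 → ℂ)}
    (hΦ : Φ ∈ holCotForms (↥(maximalRealSubfield L)) L (IsCMField.complexConj L) 3 H (cmArchSection L ι H T hT) (cmCompactFactor L ι H T hT))
    (hPΦ : P.ContainsForm Φ) (v : Fin 2 → P.archModuleCM ι T hT)
    (hv' : ∀ j : Fin 2, ∃ hm : MemLp (toQuotFun (adelicGroupData (↥(maximalRealSubfield L)) L (IsCMField.complexConj L) 3 H) fun x => Φ x j) 2 μ,
      (((v j : P.archModuleCM ι T hT) : P.space.toSubmodule) : (adelicGroupData (↥(maximalRealSubfield L)) L (IsCMField.complexConj L) 3 H).L2 μ) =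
        hm.toLp _)
    (hEn : ∀ e ∈ Submodule.span ℂ (Set.range v), ∀ s : (Fin 2 × Fin 1) × Fin 2, pOp (P.archRepLieCM ι T hT) Complex.I (upqPBasis s) e = 0)
    (hEk : ∀ W ∈ (uFormGroup (Fin 2) (Fin 1)).kInLie, ∀ e ∈ Submodule.span ℂ (Set.range v), P.archRepLieCM ι T hT W e ∈ Submodule.span ℂ (Set.range v))
    (hEK : ∀ (k : (uFormGroup (Fin 2) (Fin 1)).maximalCompact), ∀ e ∈ Submodule.span ℂ (Set.range v),
      P.archRepKCM ι T hT k e ∈ Submodule.span ℂ (Set.range v))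
    {w : ℂ} (hw : ∀ e ∈ Submodule.span ℂ (Set.range v), P.archRepLieCM ι T hT (upqZ0 (Fin 2) (Fin 1)) e = w • e)
    (W : ContRepresentation.ClosedSubrep (P.archRepCM ι T hT))
    (hW : ∀ y : P.space.toSubmodule, y ∈ W ↔
      (y : (adelicGroupData (↥(maximalRealSubfield L)) L (IsCMField.complexConj L) 3 H).L2 μ) ∈
        (l2OfForms (adelicGroupData (↥(maximalRealSubfield L)) L (IsCMField.complexConj L) 3 H) μ
          (Submodule.span ℂ (Set.range fun p : List u21Group.lie × Fin 2 =>
            iterLieDeriv (H := u21Group) (cmArchSection L ι H T hT) p.1 fun x => Φ x p.2))).topologicalClosure) :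
    W.toSubmodule.comap (P.archModuleCM ι T hT).subtype = gen (P.archRepLieCM ι T hT) Complex.I (Submodule.span ℂ (Set.range v)) := by
  haveI := compactSpace_automorphicQuotient_cm hdef h2 (L := L) (ι := ι) (H := H)
  have hv : ∀ j : Fin 2, (((v j : P.archModuleCM ι T hT) : P.space.toSubmodule) : (adelicGroupData (↥(maximalRealSubfield L)) L (IsCMField.complexConj L) 3 H).L2 μ) =
      (memLp_toQuotFun_apply ι T hT (μ := μ) hΦ j).toLp (toQuotFun (adelicGroupData (↥(maximalRealSubfield L)) L (IsCMField.complexConj L) 3 H) fun x => Φ x j) :=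
    fun j => by obtain ⟨hm, h⟩ := hv' j; exact h
  refine le_antisymm (fun x hx => ?_) fun x hx => ?_
  · exact mem_gen_of_coe_mem_holClosure ι T hT hdef h2 μ P hΦ hPΦ v hv' hEn hEk hEK hw ((hW _).1 hx)
  · exact (hW _).2 (Submodule.le_topologicalClosure _ (coe_mem_l2OfForms_of_mem_gen ι T hT P hΦ v hv hx))

/-- **`W_Φ` IS TOPOLOGICALLY IRREDUCIBLE under `U(2,1)`.**  For `Φ` a holomorphic cotangent form with square-integrable classes in `P` (compact CM
setting `hdef`, `h2`) and `W_Φ ≤ P.archRepCM ι T hT` the closed invariant subspace of classes of `P` in the `L²`-closure `C_Φ` of the `𝔤`-span of `Φ`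
(★ B5c `exists_closedSubrep_hol`), `W_Φ.toContRep.IsTopIrreducible`.  Assembly of §1 at the pin: core `= gen` (`core_holClosure_eq_gen` on the null core of
★ `valueMap_hol` ∕ ★ `nullCore_of_valueMap`), non-zero (`Φ ≠ 0`), dense (★ B4b `l2OfForms_eq_map_gen` read through the closed embedding `P ↪ L²`),
irreducible (★ B1 `eq_bot_or_eq_gen_of_isGKSubmodule` with the cotangent `K`-type ★ `F0P3HolFormKType.hEirr_cm`).
[cite: HarishChandra1953, §9 and Thm. 5] [cite: BorelWallach2000, 0 §2.4–2.5, II §4.1 and VII 3.2] [cite: Dixmier1977, §13.1.5] -/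
theorem isTopIrreducible_holClosure
    (hdef : ∀ τ' : L →+* ℂ, InfinitePlace.mk τ' ≠ InfinitePlace.mk ι → (H.map τ').PosDef) (h2 : 2 ≤ Module.finrank ℚ ↥(maximalRealSubfield L))
    (μ : Measure (adelicGroupData (↥(maximalRealSubfield L)) L (IsCMField.complexConj L) 3 H).automorphicQuotient)
    [(adelicGroupData (↥(maximalRealSubfield L)) L (IsCMField.complexConj L) 3 H).IsAutomorphicMeasure μ]
    (P : DiscreteAutomorphicRep (adelicGroupData (↥(maximalRealSubfield L)) L (IsCMField.complexConj L) 3 H) μ)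
    {Φ : (adelicGroupData (↥(maximalRealSubfield L)) L (IsCMField.complexConj L) 3 H).Adelic → (Fin 2 → ℂ)}
    (hΦ : Φ ∈ holCotForms (↥(maximalRealSubfield L)) L (IsCMField.complexConj L) 3 H (cmArchSection L ι H T hT) (cmCompactFactor L ι H T hT))
    (hΦ0 : Φ ≠ 0) (hPΦ : P.ContainsForm Φ)
    (W : ContRepresentation.ClosedSubrep (P.archRepCM ι T hT))
    (hW : ∀ y : P.space.toSubmodule, y ∈ W ↔
      (y : (adelicGroupData (↥(maximalRealSubfield L)) L (IsCMField.complexConj L) 3 H).L2 μ) ∈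
        (l2OfForms (adelicGroupData (↥(maximalRealSubfield L)) L (IsCMField.complexConj L) 3 H) μ
          (Submodule.span ℂ (Set.range fun p : List u21Group.lie × Fin 2 =>
            iterLieDeriv (H := u21Group) (cmArchSection L ι H T hT) p.1 fun x => Φ x p.2))).topologicalClosure) :
    W.toContRep.IsTopIrreducible := by
  haveI := compactSpace_automorphicQuotient_cm hdef h2 (L := L) (ι := ι) (H := H)
  -- the coordinate classes, the value map and the null core (as in ★ `archIsotypy_of_hol`)
  have hP : ∀ j : Fin 2, (memLp_toQuotFun_apply ι T hT (μ := μ) hΦ j).toLp _ ∈ P.space.toSubmodule :=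
    fun j => by obtain ⟨hm, h⟩ := hPΦ j; exact h
  obtain ⟨v, hv⟩ := exists_vectors ι T hT P hΦ hP
  have hv' : ∀ j : Fin 2, ∃ hm : MemLp (toQuotFun (adelicGroupData (↥(maximalRealSubfield L)) L (IsCMField.complexConj L) 3 H) fun x => Φ x j) 2 μ,
      (((v j : P.archModuleCM ι T hT) : P.space.toSubmodule) : (adelicGroupData (↥(maximalRealSubfield L)) L (IsCMField.complexConj L) 3 H).L2 μ) =
        hm.toLp _ := fun j => ⟨_, hv j⟩
  obtain ⟨φ, hφ⟩ := exists_valueMap LinearMap.id v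
  have hφ' : ∀ Y : (uFormGroup (Fin 2) (Fin 1)).lie,
      φ Y = ∑ j : Fin 2, ((Y : Matrix (Fin 2 ⊕ Fin 1) (Fin 2 ⊕ Fin 1) ℂ) (Sum.inl j) (Sum.inr 0)) • v j := hφ
  obtain ⟨-, hK, hk, hwt, hN, hne⟩ := valueMap_hol ι T hT P hΦ v hv φ hφ'
  obtain ⟨hw, hEn, hEk, hEK, hE⟩ := nullCore_of_valueMap (ρK := P.archRepKCM ι T hT) (ρ𝔤 := P.archRepLieCM ι T hT) v φ hφ' hK hk hwt hN
  have hE0 : Submodule.span ℂ (Set.range v) ≠ ⊥ := hE (hne hΦ0)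
  haveI : FiniteDimensional ℂ (Submodule.span ℂ (Set.range v)) := FiniteDimensional.span_of_finite ℂ (Set.finite_range v)
  -- core `= gen`
  have hcg := core_holClosure_eq_gen ι T hT hdef h2 μ P hΦ hPΦ v hv' hEn hEk hEK hw W hW
  -- non-zero
  have hne' : W.toSubmodule.comap (P.archModuleCM ι T hT).subtype ≠ ⊥ := by
    rw [hcg]
    exact fun h => hE0 (eq_bot_iff.2 ((le_gen (ρ𝔤 := P.archRepLieCM ι T hT) Complex.I (Submodule.span ℂ (Set.range v))).trans h.le))
  -- irreducible (★ B1 in the Submodule currency, as in ★ `archIsotypy_of_hol`)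
  have hirr : ∀ U' : Submodule ℂ (P.archModuleCM ι T hT), IsGKSubmodule (P.archRepKCM ι T hT) (P.archRepLieCM ι T hT) U' →
      U' ≤ W.toSubmodule.comap (P.archModuleCM ι T hT).subtype →
      U' = ⊥ ∨ U' = W.toSubmodule.comap (P.archModuleCM ι T hT).subtype := by
    rw [hcg]
    have hB1 : ∀ {H₀ : Type} [NormedAddCommGroup H₀] [InnerProductSpace ℂ H₀] {V : Submodule ℂ H₀}
        {ρK : Representation ℂ (uFormGroup (Fin 2) (Fin 1)).maximalCompact V}
        {ρ𝔤 : (uFormGroup (Fin 2) (Fin 1)).lie →ₗ⁅ℝ⁆ Module.End ℂ V} {E : Submodule ℂ V},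
        (∀ (X : (uFormGroup (Fin 2) (Fin 1)).lie) (a b : V), ⟪ρ𝔤 X a, b⟫_ℂ + ⟪a, ρ𝔤 X b⟫_ℂ = 0) →
        (∀ e ∈ E, ∀ s : (Fin 2 × Fin 1) × Fin 2, pOp ρ𝔤 Complex.I (upqPBasis s) e = 0) →
        (∀ W ∈ (uFormGroup (Fin 2) (Fin 1)).kInLie, ∀ e ∈ E, ρ𝔤 W e ∈ E) →
        (∀ (k : (uFormGroup (Fin 2) (Fin 1)).maximalCompact), ∀ e ∈ E, ρK k e ∈ E) →
        (∀ e ∈ E, ρ𝔤 (upqZ0 (Fin 2) (Fin 1)) e = Complex.I • e) →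
        (∀ F : Submodule ℂ V, F ≤ E → (∀ (k : (uFormGroup (Fin 2) (Fin 1)).maximalCompact), ∀ f ∈ F, ρK k f ∈ F) → F = ⊥ ∨ F = E) →
        ∀ {W : Submodule ℂ V}, IsGKSubmodule ρK ρ𝔤 W → W ≤ gen ρ𝔤 Complex.I E → W = ⊥ ∨ W = gen ρ𝔤 Complex.I E :=
      fun hU hEn hEk hEK hw hEirr _ hW hWle => eq_bot_or_eq_gen_of_isGKSubmodule hU Complex.I_mul_I hEn hEk hEK hw hEirr hW hWle
    exact fun U' hU' hle => hB1 (inner_archRepLieCM_skew ι T hT P) hEn hEk hEK hw (F0P3HolFormKType.hEirr_cm ι T hT hdef h2 μ P hΦ v hv') hU' hle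
  -- dense: `W_Φ` is the closure of the image of `gen` (★ B4b), read through the closed embedding `P ↪ L²`
  have hdense : W.toSubmodule ≤ ((W.toSubmodule.comap (P.archModuleCM ι T hT).subtype).map (P.archModuleCM ι T hT).subtype).topologicalClosure := by
    rw [hcg]
    intro y hy
    have hyC := (hW _).1 hy
    have himg : (l2OfForms (adelicGroupData (↥(maximalRealSubfield L)) L (IsCMField.complexConj L) 3 H) μ
          (Submodule.span ℂ (Set.range fun p : List u21Group.lie × Fin 2 =>
            iterLieDeriv (H := u21Group) (cmArchSection L ι H T hT) p.1 fun x => Φ x p.2)) :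
          Set ((adelicGroupData (↥(maximalRealSubfield L)) L (IsCMField.complexConj L) 3 H).L2 μ)) =
        Subtype.val '' (((gen (P.archRepLieCM ι T hT) Complex.I (Submodule.span ℂ (Set.range v))).map (P.archModuleCM ι T hT).subtype :
          Submodule ℂ P.space.toSubmodule) : Set P.space.toSubmodule) := by
      rw [l2OfForms_eq_map_gen ι T hT P hΦ v hv hEn hEk hEK, Submodule.map_comp, Submodule.map_coe]
      rfl
    rw [← SetLike.mem_coe, Submodule.topologicalClosure_coe, Topology.IsEmbedding.subtypeVal.closure_eq_preimage_closure_image,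
      Set.mem_preimage, ← himg, ← Submodule.topologicalClosure_coe]
    exact hyC
  exact isTopIrreducible_of_core P (uFormGroup (Fin 2) (Fin 1)) (cmArchSectionUForm L ι H T hT) (continuous_cmArchSectionUForm L ι H T hT) W hne' hdense hirr

/-- **∃-packaged form**: a holomorphic cotangent form `Φ ≠ 0` with classes in `P` yields a TOPOLOGICALLY IRREDUCIBLE closed `U(2,1)`-invariant
`W ≤ P.archRepCM ι T hT` containing the coordinate classes `[Φ₀], [Φ₁]` (the closure `C_Φ`; ★ B5c `exists_closedSubrep_hol` + `isTopIrreducible_holClosure`).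
[cite: HarishChandra1953, Thm. 5] [cite: BorelWallach2000, VII 3.2] -/
theorem exists_isTopIrreducible_closedSubrep_hol
    (hdef : ∀ τ' : L →+* ℂ, InfinitePlace.mk τ' ≠ InfinitePlace.mk ι → (H.map τ').PosDef) (h2 : 2 ≤ Module.finrank ℚ ↥(maximalRealSubfield L))
    (μ : Measure (adelicGroupData (↥(maximalRealSubfield L)) L (IsCMField.complexConj L) 3 H).automorphicQuotient)
    [(adelicGroupData (↥(maximalRealSubfield L)) L (IsCMField.complexConj L) 3 H).IsAutomorphicMeasure μ]
    (P : DiscreteAutomorphicRep (adelicGroupData (↥(maximalRealSubfield L)) L (IsCMField.complexConj L) 3 H) μ)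
    {Φ : (adelicGroupData (↥(maximalRealSubfield L)) L (IsCMField.complexConj L) 3 H).Adelic → (Fin 2 → ℂ)}
    (hΦ : Φ ∈ holCotForms (↥(maximalRealSubfield L)) L (IsCMField.complexConj L) 3 H (cmArchSection L ι H T hT) (cmCompactFactor L ι H T hT))
    (hΦ0 : Φ ≠ 0) (hPΦ : P.ContainsForm Φ) :
    ∃ W : ContRepresentation.ClosedSubrep (P.archRepCM ι T hT), W.toContRep.IsTopIrreducible ∧
      (∀ y : P.space.toSubmodule, y ∈ W ↔
        (y : (adelicGroupData (↥(maximalRealSubfield L)) L (IsCMField.complexConj L) 3 H).L2 μ) ∈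
          (l2OfForms (adelicGroupData (↥(maximalRealSubfield L)) L (IsCMField.complexConj L) 3 H) μ
            (Submodule.span ℂ (Set.range fun p : List u21Group.lie × Fin 2 =>
              iterLieDeriv (H := u21Group) (cmArchSection L ι H T hT) p.1 fun x => Φ x p.2))).topologicalClosure) ∧
      ∀ (j : Fin 2) (y : P.space.toSubmodule),
        (∃ hm : MemLp (toQuotFun (adelicGroupData (↥(maximalRealSubfield L)) L (IsCMField.complexConj L) 3 H) fun x => Φ x j) 2 μ,
          (y : (adelicGroupData (↥(maximalRealSubfield L)) L (IsCMField.complexConj L) 3 H).L2 μ) = hm.toLp _) → y ∈ W := by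
  obtain ⟨W, hW⟩ := exists_closedSubrep_hol ι T hT hdef h2 μ P hΦ hPΦ
  refine ⟨W, isTopIrreducible_holClosure ι T hT hdef h2 μ P hΦ hΦ0 hPΦ W hW, hW, fun j y hy => (hW _).2 ?_⟩
  haveI := compactSpace_automorphicQuotient_cm hdef h2 (L := L) (ι := ι) (H := H)
  have hP : ∀ j : Fin 2, (memLp_toQuotFun_apply ι T hT (μ := μ) hΦ j).toLp _ ∈ P.space.toSubmodule :=
    fun j => by obtain ⟨hm, h⟩ := hPΦ j; exact h
  obtain ⟨v, hv⟩ := exists_vectors ι T hT P hΦ hP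
  have h := coe_mem_l2OfForms_of_mem_gen ι T hT P hΦ v hv (le_gen (ρ𝔤 := P.archRepLieCM ι T hT) Complex.I _ (Submodule.subset_span ⟨j, rfl⟩))
  obtain ⟨hm, hy⟩ := hy
  rw [hv j] at h
  rw [hy]
  exact Submodule.le_topologicalClosure _ h

/-- **For a hol-type `P`** (`P.IsHolCotangentAt`): `P|_{U(2,1)}` contains a topologically irreducible closed subrepresentation.  This is the
hypothesis `hW` of HB1 `F0P3IsotypicOfCommutingFactor.archRepCM_isotypicComponent_eq_top` discharged at the pin. [cite: HarishChandra1953, Thm. 5]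
[cite: BorelWallach2000, VII 3.2] -/
theorem exists_isTopIrreducible_closedSubrep_of_isHolCotangentAt
    (hdef : ∀ τ' : L →+* ℂ, InfinitePlace.mk τ' ≠ InfinitePlace.mk ι → (H.map τ').PosDef) (h2 : 2 ≤ Module.finrank ℚ ↥(maximalRealSubfield L))
    (μ : Measure (adelicGroupData (↥(maximalRealSubfield L)) L (IsCMField.complexConj L) 3 H).automorphicQuotient)
    [(adelicGroupData (↥(maximalRealSubfield L)) L (IsCMField.complexConj L) 3 H).IsAutomorphicMeasure μ]
    (P : DiscreteAutomorphicRep (adelicGroupData (↥(maximalRealSubfield L)) L (IsCMField.complexConj L) 3 H) μ)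
    (hP : P.IsHolCotangentAt (cmArchSection L ι H T hT) (cmCompactFactor L ι H T hT)) :
    ∃ W : ContRepresentation.ClosedSubrep (P.archRepCM ι T hT), W.toContRep.IsTopIrreducible := by
  obtain ⟨Φ, hΦ, hΦ0, hPΦ⟩ := hP
  obtain ⟨W, hW, -, -⟩ := exists_isTopIrreducible_closedSubrep_hol ι T hT hdef h2 μ P hΦ hΦ0 hPΦ
  exact ⟨W, hW⟩

end CM

end Summit.HodgeConjecture.HodgeConjecture.Cruxes.H413.F0P3HolClosureIrreducible

end
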